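import Summits.QuantumAdvantage.QuantumAdvantage.Theorems.SpreadDialNandRing
import Summits.QuantumAdvantage.QuantumAdvantage.Theorems.SpreadDialNoShadowLemmas
import HarnessLib

/-!
# Parity-product foreign rings, part 3/3: dense foreign win events have NO algebraic shadow
(negative knowledge for item stmt-QuantumAdvantage-30910 `SpreadDial.PureCover3`)

Cell decomp-qadv, seat lens-5 («finite range + asymptotic regime + bridge»), generation 8 — land port of
`noShadow3 : ¬ ShadowLaw3` of the node «TameDial» (sha256 fd9002fb…), statement inlined (no new `Prop`).

**Theorem `spreadDial_noAlgebraicShadow3`.** There is NO constant `C ≥ 1` such that for every `η > 0`, `k`, `c`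
some exponent `c'` makes every dense (`≥ (1-η)2^n`) foreign win event of `m ≤ n^k` rings of degree `≤ (log₂ n)^c`
contain, up to `2^n/n^(k+1)` points, a `{0,1}`-valued polynomial event `{ψ = 1}` of degree `≤ (log₂ n)^c'` and size
`≥ (1 - Cη)2^n`.  Witness: ONE ring (`m = 1 ≤ n^0`, degree `r ≤ (log₂ n)^1`), the NAND ring of part 1 with `r` blocks
of size `2^s` at length `n = 8t = 2^{rs+3}` (`4C ≤ 2^r`, `η = 2^{-r}`): by the Walsh expansion and the two-sided
Smolensky bound of part 2, every `{0,1}`-valued `ψ` of degree `≤ (log₂ n)^{c'}` with `#{ψ=1} ≥ (1 - C·2^{-r})2^n ≥ ¾·2^n`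
has `≥ (5/8)·2^{-r}·2^n > 2^n/n` ones inside the ALL-ODD event, i.e. OUTSIDE the win event.

Consequence for route SpreadDial (route-QuantumAdvantage-SpreadDial, residual `PureCover3` = stmt-30910): the road
"foreign algebraic spread (`AlgSpread3`) + inner algebraic approximation of the foreign win event" is CLOSED — any
proof of `PureCover3` must spend the victim's PROMISE on non-algebraic (parity-product) foreign events.  This is the
certified negative half of the lens-5 TameDial node; the positive halves (`AlgCover3`-base, short/mixed parity blocks)
are in the node.
-/

set_option linter.style.longLine false
set_option linter.dupNamespace false

open Finset
open Literature.Computability.QuantumComplexity Literature.Computability.MetaComplexity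
open Literature.Computability.QuantumComplexity.RingHLF

namespace Summit.QuantumAdvantage.QuantumAdvantage.Theorems

open TameDial in
/-- **No algebraic shadow** (the lens-5 `ShadowLaw3` is FALSE; statement inlined verbatim). [kernel] -/
theorem spreadDial_noAlgebraicShadow3 : ¬ (
  ∃ C : ℝ, 1 ≤ C ∧ ∀ η : ℝ, 0 < η → ∀ k c : ℕ, ∃ c' n₀ : ℕ, ∀ n ≥ n₀, ∀ m : ℕ, m ≤ n ^ k →
    ∀ w : Fin m → Fin n → Bool, ∀ Q : Fin m → Fin n → Smolensky.CubeFn (ZMod 3) n,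
      (∀ t i, Q t i ∈ Smolensky.lowDeg (ZMod 3) n ((Nat.log 2 n) ^ c)) →
      (1 - η) * (2 : ℝ) ^ n ≤ ((univ.filter fun y : Fin n → Bool =>
          ∀ t, RingHLF.Rel (w t) (fun i => decide (Q t i y = 1))).card : ℝ) →
      ∃ ψ : Smolensky.CubeFn (ZMod 3) n, ψ ∈ Smolensky.lowDeg (ZMod 3) n ((Nat.log 2 n) ^ c') ∧
        (∀ y, ψ y = 0 ∨ ψ y = 1) ∧
        (1 - C * η) * (2 : ℝ) ^ n ≤ ((univ.filter fun y : Fin n → Bool => ψ y = 1).card : ℝ) ∧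
        ((univ.filter fun y : Fin n → Bool =>
            ψ y = 1 ∧ ¬ ∀ t, RingHLF.Rel (w t) (fun i => decide (Q t i y = 1))).card : ℝ)
          ≤ (2 : ℝ) ^ n / (n : ℝ) ^ (k + 1)) := by
  classical
  rintro ⟨C, hC1, hlaw⟩
  -- (1) parameters
  obtain ⟨r, hr4⟩ : ∃ r : ℕ, 4 * C ≤ (2 : ℝ) ^ r := by
    obtain ⟨r, hr⟩ := pow_unbounded_of_one_lt (4 * C) (by norm_num : (1 : ℝ) < 2)
    exact ⟨r, hr.le⟩
  have hr1 : 1 ≤ r := by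
    rcases Nat.eq_zero_or_pos r with h | h
    · subst h; norm_num at hr4; linarith
    · exact h
  have h2r : (0 : ℝ) < (2 : ℝ) ^ r := by positivity
  obtain ⟨c', n₀, hn₀⟩ := hlaw (1 / (2 : ℝ) ^ r) (by positivity) 0 1
  obtain ⟨s, hs1, hsn₀, hsD⟩ := exists_scale r c' n₀ hr1
  obtain ⟨t, ht, ht1, h8t, hlog⟩ : ∃ t : ℕ, t = 2 ^ (r * s) ∧ 1 ≤ t ∧ 8 * t = 2 ^ (r * s + 3) ∧
      Nat.log 2 (8 * t) = r * s + 3 := by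
    refine ⟨2 ^ (r * s), rfl, Nat.one_le_two_pow, by rw [pow_add]; ring, ?_⟩
    rw [show 8 * 2 ^ (r * s) = 2 ^ (r * s + 3) by rw [pow_add]; ring, Nat.log_pow (by norm_num)]
  have hrs : r + 3 ≤ r * s + 3 := by nlinarith
  have h2s : 0 < 2 ^ s := by positivity
  have hrn : r * 2 ^ s ≤ 8 * t := by
    have h1 : r ≤ 2 ^ r := Nat.lt_two_pow_self.le
    rw [h8t]
    calc r * 2 ^ s ≤ 2 ^ r * 2 ^ s := Nat.mul_le_mul_right _ h1
      _ = 2 ^ (r + s) := by rw [pow_add]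
      _ ≤ 2 ^ (r * s + 3) := Nat.pow_le_pow_right (by norm_num) (by nlinarith)
  have hr3n : r + 3 ≤ 8 * t := by
    rw [h8t]; exact le_trans hrs Nat.lt_two_pow_self.le
  -- (2) the blocks
  let T : Fin r → Finset (Fin (8 * t)) := fun j => univ.filter fun a => a.val / 2 ^ s = j.val
  have hTmem : ∀ j (a : Fin (8 * t)), a ∈ T j ↔ a.val / 2 ^ s = j.val := fun j a => by
    simp only [T, mem_filter, mem_univ, true_and]
  have hTcard : ∀ j, (T j).card = 2 ^ s := by
    intro j
    have hj : (j.val + 1) * 2 ^ s ≤ 8 * t := le_trans (Nat.mul_le_mul_right _ (Nat.succ_le_of_lt j.isLt)) hrn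
    refine Finset.card_eq_of_bijective (fun i hi => ⟨j.val * 2 ^ s + i, by nlinarith⟩) ?_ ?_ ?_
    · intro a ha
      rw [hTmem] at ha
      have hdm := Nat.div_add_mod a.val (2 ^ s)
      rw [ha] at hdm
      exact ⟨a.val % 2 ^ s, Nat.mod_lt _ h2s, Fin.ext (by dsimp only; linarith)⟩
    · intro i hi
      rw [hTmem]
      dsimp only
      rw [add_comm, Nat.add_mul_div_right _ _ h2s, Nat.div_eq_of_lt hi, zero_add]
    · intro i i' hi hi' h
      have := Fin.mk.inj_iff.mp h
      omega
  have hTdisj : ∀ i j, i ≠ j → Disjoint (T i) (T j) := by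
    intro i j hij
    rw [Finset.disjoint_left]
    intro a ha hb
    rw [hTmem] at ha hb
    exact hij (Fin.ext (by omega))
  have hprod : (∏ j, (T j).card) ≤ 4 * t := by
    rw [Finset.prod_congr rfl fun j _ => hTcard j, Finset.prod_const, Finset.card_univ, Fintype.card_fin,
      ← pow_mul, mul_comm s r, ← ht]
    omega
  obtain ⟨Q₁, hQ₁deg, hQ₁win⟩ := exists_nand_ring ht1 T hprod
  -- (3) characters of unions of blocks
  have hσ : ∀ j y, sgnOn (T j) y = 1 ∨ sgnOn (T j) y = -1 := fun j y => sgnOn_cases _ _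
  have hchar : ∀ (S : Finset (Fin (8 * t) → Bool)) (J : Finset (Fin r)),
      ∑ y ∈ S, ∏ j ∈ J, sgnOn (T j) y = ∑ y ∈ S, sgnOn (J.biUnion T) y :=
    fun S J => Finset.sum_congr rfl fun y _ => (sgnOn_biUnion J T (fun i _ j _ hij => hTdisj i j hij) y).symm
  have hJcard : ∀ J : Finset (Fin r), (J.biUnion T).card = J.card * 2 ^ s := by
    intro J
    rw [Finset.card_biUnion (fun i _ j _ hij => hTdisj i j hij), Finset.sum_congr rfl fun j _ => hTcard j,
      Finset.sum_const, smul_eq_mul]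
  have hJne : ∀ J : Finset (Fin r), J.Nonempty → (J.biUnion T).Nonempty := by
    intro J hJ
    rw [← Finset.card_pos, hJcard]
    exact Nat.mul_pos (Finset.card_pos.mpr hJ) h2s
  -- (4) #AND · 2^r = 2^n   (AND := every block parity odd)
  have hσuniv : ∀ J : Finset (Fin r), J.Nonempty →
      |∑ y ∈ (univ : Finset (Fin (8 * t) → Bool)), ∏ j ∈ J, sgnOn (T j) y| ≤ 0 := by
    intro J hJ
    rw [hchar]
    obtain ⟨hev, hod⟩ := card_parity_classes (J.biUnion T) (hJne J hJ)
    rw [Finset.sum_congr rfl fun y _ => sgnOn_eq_ite _ y, Finset.sum_ite, Finset.sum_const, Finset.sum_const,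
      nsmul_eq_mul, nsmul_eq_mul]
    have hneg : (univ.filter fun y : Fin (8 * t) → Bool => ¬ pc (J.biUnion T) y % 2 = 0) =
        univ.filter fun y : Fin (8 * t) → Bool => pc (J.biUnion T) y % 2 = 1 := filter_congr fun y _ => by omega
    rw [hneg, hev, hod]
    simp
  have hAND := walsh_allOdd (fun j => sgnOn (T j)) hσ (univ : Finset (Fin (8 * t) → Bool)) 0 hσuniv
    (univ.filter fun y : Fin (8 * t) → Bool => ∀ j, pc (T j) y % 2 = 1) (fun y => by
      simp only [Finset.mem_filter, Finset.mem_univ, true_and]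
      exact forall_congr' fun j => (sgnOn_eq_neg_one_iff (T j) y).symm)
  rw [Fintype.card_fin, Finset.card_univ, Fintype.card_fun, Fintype.card_bool, Fintype.card_fin, mul_zero,
    abs_nonpos_iff, sub_eq_zero] at hAND
  push_cast at hAND
  -- hAND : 2 ^ r * #AND = 2 ^ (8 t)   (in ℤ)
  -- (5) #NAND as a real number
  have hNAND : ((univ.filter fun y : Fin (8 * t) → Bool => ¬ ∀ j, pc (T j) y % 2 = 1).card : ℝ) =
      (2 : ℝ) ^ (8 * t) - (2 : ℝ) ^ (8 * t) / (2 : ℝ) ^ r := by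
    have hsplit := Finset.card_filter_add_card_filter_not (s := (univ : Finset (Fin (8 * t) → Bool)))
      (fun y => ∀ j, pc (T j) y % 2 = 1)
    rw [Finset.card_univ, Fintype.card_fun, Fintype.card_bool, Fintype.card_fin] at hsplit
    have h1 : ((univ.filter fun y : Fin (8 * t) → Bool => ∀ j, pc (T j) y % 2 = 1).card : ℝ) =
        (2 : ℝ) ^ (8 * t) / (2 : ℝ) ^ r := by
      rw [eq_div_iff h2r.ne']
      have h := congrArg (Int.cast : ℤ → ℝ) hAND
      push_cast at h
      linarith
    have h2 := congrArg (Nat.cast : ℕ → ℝ) hsplit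
    push_cast at h2
    linarith
  -- (6) apply the law to the single ring (its win event is NAND, by `hQ₁win`)
  obtain ⟨ψ, hψdeg, hψ01, hψdens, hψleak⟩ := hn₀ (8 * t) (by rw [ht]; exact hsn₀) 1 (by simp)
    ![Theorems.delta0 t] ![Q₁] (by
      rw [Fin.forall_fin_one, pow_one, hlog]
      intro i
      exact Smolensky.lowDeg_mono (by nlinarith) (hQ₁deg i)) (by
      have e : (1 - 1 / (2 : ℝ) ^ r) * (2 : ℝ) ^ (8 * t) = (2 : ℝ) ^ (8 * t) - (2 : ℝ) ^ (8 * t) / (2 : ℝ) ^ r := by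
        field_simp
      rw [e, ← hNAND]
      exact_mod_cast Finset.card_le_card fun y hy => by
        simp only [Finset.mem_filter, Finset.mem_univ, true_and] at hy ⊢
        exact Fin.forall_fin_one.mpr ((hQ₁win y).mpr hy))
  -- (7) the leak set contains  oneSet ψ ∩ AND
  have hXle : ((((oneSet ψ).filter fun y => ∀ j, pc (T j) y % 2 = 1).card : ℕ) : ℝ) ≤
      (2 : ℝ) ^ (8 * t) / ((8 * t : ℕ) : ℝ) := by
    rw [zero_add, pow_one] at hψleak
    refine le_trans ?_ hψleak
    exact_mod_cast Finset.card_le_card fun y hy => by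
      simp only [Finset.mem_filter, Finset.mem_univ, true_and, mem_oneSet] at hy ⊢
      refine ⟨hy.1, fun h => ?_⟩
      exact ((hQ₁win y).mp (Fin.forall_fin_one.mp h)) hy.2
  -- (8) Walsh on oneSet ψ with β = 2^(8t - r - 3)
  have hD1 : ((r * s + 3) ^ c') ^ 2 * 4 ^ (r + 3) ≤ 2 ^ s := hsD
  have hW := walsh_allOdd (fun j => sgnOn (T j)) hσ (oneSet ψ) (2 ^ (8 * t - r - 3)) (by
    intro J hJ
    rw [hchar]
    refine le_trans (abs_sum_sgnOn_le (J.biUnion T) (hJne J hJ) hψdeg hψ01) ?_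
    rw [hlog]
    have hmn : (J.biUnion T).card ≤ 8 * t := by
      have := Finset.card_le_univ (J.biUnion T); rwa [Fintype.card_fin] at this
    have hDm : ((r * s + 3) ^ c') ^ 2 * 4 ^ (r + 3) ≤ (J.biUnion T).card := by
      refine le_trans hD1 ?_
      rw [hJcard]
      exact Nat.le_mul_of_pos_left _ (Finset.card_pos.mpr hJ)
    exact_mod_cast err_le hmn hDm)
    ((oneSet ψ).filter fun y => ∀ j, pc (T j) y % 2 = 1) (fun y => by
      simp only [Finset.mem_filter, mem_oneSet]
      exact and_congr_right fun _ => forall_congr' fun j => (sgnOn_eq_neg_one_iff (T j) y).symm)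
  rw [Fintype.card_fin] at hW
  -- (9) the contradiction, in ℝ
  have hM : (0 : ℝ) < (2 : ℝ) ^ (8 * t) := by positivity
  have hB0 : (0 : ℝ) ≤ (2 : ℝ) ^ (8 * t - r - 3) := by positivity
  have hPB : (2 : ℝ) ^ r * (2 : ℝ) ^ (8 * t - r - 3) = (2 : ℝ) ^ (8 * t) / 8 := by
    rw [eq_div_iff (by norm_num : (8 : ℝ) ≠ 0), show (8 : ℝ) = 2 ^ 3 by norm_num, ← pow_add, ← pow_add]
    congr 1
    omega
  set X := ((oneSet ψ).filter fun y => ∀ j, pc (T j) y % 2 = 1).card with hX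
  have hW' : ((oneSet ψ).card : ℝ) - (2 : ℝ) ^ r * (2 : ℝ) ^ (8 * t - r - 3) + (2 : ℝ) ^ (8 * t - r - 3) ≤
      (2 : ℝ) ^ r * X := by
    have h := (abs_le.mp hW).1
    have h' := (Int.cast_le (R := ℝ)).mpr h
    push_cast at h'
    linarith
  have hdens : (3 / 4 : ℝ) * (2 : ℝ) ^ (8 * t) ≤ ((oneSet ψ).card : ℝ) := by
    have h1 : C * (1 / (2 : ℝ) ^ r) * (2 : ℝ) ^ (8 * t) ≤ 1 / 4 * (2 : ℝ) ^ (8 * t) := by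
      apply mul_le_mul_of_nonneg_right _ hM.le
      rw [mul_one_div, div_le_iff₀ h2r]
      linarith
    have h2 : (1 - C * (1 / (2 : ℝ) ^ r)) * (2 : ℝ) ^ (8 * t) =
        (2 : ℝ) ^ (8 * t) - C * (1 / (2 : ℝ) ^ r) * (2 : ℝ) ^ (8 * t) := by ring
    have h3 := hψdens
    rw [h2] at h3
    change _ ≤ ((oneSet ψ).card : ℝ) at h3
    linarith
  have hleak' : (2 : ℝ) ^ r * X * 8 ≤ (2 : ℝ) ^ (8 * t) := by
    have h8t' : (((8 * t : ℕ) : ℝ)) = (2 : ℝ) ^ (r * s + 3) := by rw [h8t]; push_cast; ring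
    have hle : (2 : ℝ) ^ r * 8 ≤ ((8 * t : ℕ) : ℝ) := by
      rw [h8t', show (8 : ℝ) = 2 ^ 3 by norm_num, ← pow_add]
      exact pow_le_pow_right₀ (by norm_num) hrs
    have hpos : (0 : ℝ) < ((8 * t : ℕ) : ℝ) := by positivity
    have hX0 : (0 : ℝ) ≤ X := by positivity
    have h1 : (X : ℝ) * ((8 * t : ℕ) : ℝ) ≤ (2 : ℝ) ^ (8 * t) := by
      rw [← le_div_iff₀ hpos]; exact hXle
    calc (2 : ℝ) ^ r * X * 8 = (X : ℝ) * ((2 : ℝ) ^ r * 8) := by ring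
      _ ≤ (X : ℝ) * ((8 * t : ℕ) : ℝ) := mul_le_mul_of_nonneg_left hle hX0
      _ ≤ (2 : ℝ) ^ (8 * t) := h1
  linarith


end Summit.QuantumAdvantage.QuantumAdvantage.Theorems
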